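import Summits.KontsevichZagierPeriods.KontsevichZagierPeriods.Theorems.RootDecompRationalCubeDichotomyPiRationalisationSqrtMoves

/-!
# Route RootDecompRationalCubeDichotomy — rung of item 24903, part 2/3: the doubling and fibred Möbius
# substitutions; the rung statements `PiRationalisationSqrtOne` (n = 1) and `PiRationalisationSqrt` (all n)

Support for item stmt-KontsevichZagierPeriods-24903; closes no item. Instances of the fibred substitution move of part 1:
`of_sub_of_mem_relations_doubling` (`σ = 2t/(1+2t−t²)`), `of_sub_of_mem_relations_sqrtMoebiusN` (the fibred Möbius
substitution `σ = σ'/(√p + (1−√p)σ')` over the base cube `[0,1]^m`, which makes `c·dσ/((1−σ)²+σ²)` RATIONAL, `c² = p`);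
representations from continuous data (`contRep`); and the two rung statements, verbatim from the lens node:
`PiRationalisationSqrtOne` and `PiRationalisationSqrt` = for `s = [[0,1]ⁿ, a₁/a₂ + (b₁/b₂)·√p]` (`a₂, b₂` zero-free,
`p > 0` on the closed cube, all in `ℚ[x]`): `∀ K ≥ 1, ([π]·)^[K] [s] ∈ relations ⊔ ⟨rational closed-cube sector⟩` —
the generic DEGREE-2 layer of the item. Proofs in part 3. [Kontsevich–Zagier 2001, §1.2] Standard axioms, 0 sorry.
-/

namespace Summit.KontsevichZagierPeriods.RootDecompRationalCubeDichotomy.Rung24903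

open MeasureTheory Set MvPolynomial
open Literature.NumberTheory.Transcendental Literature.NumberTheory.Transcendental.KZ
open Literature.ModelTheory.ExponentialFields (IsSemialgebraic)
open Summit.KontsevichZagierPeriods.KontsevichZagierPeriods.Theses.RootDecompRationalCubeDichotomy
  (PiRationalisation PiTimesSector)

/-! ### Instance in dimension one: the doubling substitution -/

/-- `aeval` of a polynomial in the first `m` variables, viewed in `m + 1` variables. [folklore] -/
theorem aeval_rename_castSucc {m : ℕ} (z : Fin (m + 1) → ℝ) (q : MvPolynomial (Fin m) ℚ) :
    aeval z (rename Fin.castSucc q) = aeval (Fin.init z) q := by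
  rw [MvPolynomial.aeval_rename]; rfl

/-- Positivity of the Möbius denominator `c + (1 - c) σ = c (1 - σ) + σ` for `c > 0`, `σ ∈ [0,1]`. -/
theorem moebius_den_pos {c σ : ℝ} (hc : 0 < c) (h0 : 0 ≤ σ) (h1 : σ ≤ 1) :
    0 < c + (1 - c) * σ := by
  rcases h0.eq_or_lt with h | h
  · rw [← h]; simpa using hc
  · nlinarith [mul_nonneg hc.le (sub_nonneg.2 h1)]

/-- Positivity of `c² (1 - σ)² + σ²` for `c > 0`, `σ ∈ [0,1]`. -/
theorem sq_den_pos {c σ : ℝ} (hc : 0 < c) (h0 : 0 ≤ σ) :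
    0 < c ^ 2 * (1 - σ) ^ 2 + σ ^ 2 := by
  rcases h0.eq_or_lt with h | h
  · rw [← h]; simpa using pow_pos hc 2
  · nlinarith [sq_nonneg (c * (1 - σ)), pow_pos h 2]

/-- **The doubling substitution** `σ = 2t/(1+2t−t²)` of `[0,1]` onto itself transports
`2 dt/(1+t²)` to `dσ/((1−σ)²+σ²)`: one change-of-variables move (the case `m = 0` of
`of_sub_of_mem_relations_of_fibreMap`). [Kontsevich–Zagier 2001, §1.2, rule 2)] -/
theorem of_sub_of_mem_relations_doubling (A2 C1 : IntegralRep 1)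
    (h2d : A2.domain = {x | 0 ≤ x 0 ∧ x 0 ≤ 1}) (h2i : A2.integrand = fun x => 2 / (1 + x 0 ^ 2))
    (hCd : C1.domain = {x | 0 ≤ x 0 ∧ x 0 ≤ 1})
    (hCi : C1.integrand = fun x => 1 / ((1 - x 0) ^ 2 + x 0 ^ 2)) :
    of A2 - of C1 ∈ relations := by
  have hD : ∀ t : ℝ, 0 ≤ t → t ≤ 1 → 0 < 1 + 2 * t - t ^ 2 := fun t h0 h1 => by nlinarith
  have hmem : ∀ {z : Fin 1 → ℝ}, z ∈ A2.domain → 0 ≤ z 0 ∧ z 0 ≤ 1 := fun hz => by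
    rw [h2d] at hz; exact hz
  refine of_sub_of_mem_relations_of_fibreMap (m := 0) (G := univ) (a := fun _ => 0) (b := fun _ => 1)
    (a' := fun _ => 0) (b' := fun _ => 1)
    (fun z => 2 * z 0 / (1 + 2 * z 0 - z 0 ^ 2))
    (fun z => 2 * (1 + z 0 ^ 2) / (1 + 2 * z 0 - z 0 ^ 2) ^ 2)
    A2 C1 ?_ ?_ (fun _ _ => zero_le_one) ?_ ?_ ?_ ?_ ?_ ?_ ?_
  · rw [h2d]; ext z; simp [KZlog.mem_band]
  · rw [hCd]; ext z; simp [KZlog.mem_band]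
  · -- semialgebraic
    have hq : ∀ z ∈ A2.domain, aeval z (1 + C (2:ℚ) * X 0 - X 0 ^ 2 : MvPolynomial (Fin 1) ℚ) ≠ 0 := by
      intro z hz
      have h := hD _ (hmem hz).1 (hmem hz).2
      simp only [map_sub, map_add, map_one, map_mul, MvPolynomial.aeval_C, map_pow, MvPolynomial.aeval_X,
        eq_ratCast, Rat.cast_ofNat]
      exact h.ne'
    refine (isSemialgebraicFunOn_aeval_div_aeval A2.isSemialgebraic_domain (C (2:ℚ) * X 0)
      (1 + C (2:ℚ) * X 0 - X 0 ^ 2) hq).congr fun z _ => ?_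
    simp only [map_sub, map_add, map_one, map_mul, MvPolynomial.aeval_C, map_pow, MvPolynomial.aeval_X,
      eq_ratCast, Rat.cast_ofNat]
  · -- differentiable
    intro z hz
    have h := hD _ (hmem hz).1 (hmem hz).2
    have hnum : DifferentiableAt ℝ (fun w : Fin (0 + 1) → ℝ => 2 * w 0) z := by fun_prop
    have hden' : DifferentiableAt ℝ (fun w : Fin (0 + 1) → ℝ => 1 + 2 * w 0 - w 0 ^ 2) z := by fun_prop
    simp only [div_eq_mul_inv]
    exact hnum.fun_mul (hden'.fun_inv h.ne')
  · -- fibre derivative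
    intro z hz
    have h := hD _ (hmem hz).1 (hmem hz).2
    simp only [Fin.last_zero, show ∀ t : ℝ, (Fin.snoc (Fin.init z) t : Fin 1 → ℝ) 0 = t from
      fun t => Fin.snoc_last (α := fun _ => ℝ) (x := t) (p := Fin.init z)]
    set t₀ : ℝ := z 0 with ht₀
    have h1 : HasDerivAt (fun t : ℝ => 2 * t) (2 * 1) t₀ := (hasDerivAt_id' t₀).const_mul 2
    have h2 := (((hasDerivAt_id' t₀).const_mul (2:ℝ)).const_add (1:ℝ)).fun_sub (hasDerivAt_pow 2 t₀)
    have h3 := h1.fun_div h2 h.ne'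
    refine h3.congr_deriv ?_
    have hD0 : (1 + 2 * t₀ - t₀ ^ 2) ≠ 0 := h.ne'
    rw [div_eq_div_iff (pow_ne_zero 2 hD0) (pow_ne_zero 2 hD0)]
    push_cast
    ring
  · -- positivity of the fibre derivative
    intro z hz
    have h := hD _ (hmem hz).1 (hmem hz).2
    exact div_pos (by positivity) (pow_pos h 2)
  · intro y _
    simp only [show (Fin.snoc y (0:ℝ) : Fin 1 → ℝ) 0 = 0 from Fin.snoc_last (α := fun _ => ℝ) (x := 0) (p := y)]
    norm_num
  · intro y _
    simp only [show (Fin.snoc y (1:ℝ) : Fin 1 → ℝ) 0 = 1 from Fin.snoc_last (α := fun _ => ℝ) (x := 1) (p := y)]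
    norm_num
  · -- integrand identity
    intro z hz
    have h := hD _ (hmem hz).1 (hmem hz).2
    rw [h2i, hCi]
    simp only [show ∀ t : ℝ, (Fin.snoc (Fin.init z) t : Fin 1 → ℝ) 0 = t from
      fun t => Fin.snoc_last (α := fun _ => ℝ) (x := t) (p := Fin.init z)]
    set t : ℝ := z 0 with ht
    have hD0 : (1 + 2 * t - t ^ 2) ≠ 0 := h.ne'
    have ht2 : (1 + t ^ 2) ≠ 0 := by positivity
    have hE : (1 - 2 * t / (1 + 2 * t - t ^ 2)) ^ 2 + (2 * t / (1 + 2 * t - t ^ 2)) ^ 2 =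
        (1 + t ^ 2) ^ 2 / (1 + 2 * t - t ^ 2) ^ 2 := by
      field_simp
      ring
    rw [hE]
    field_simp

/-! ### Representations from continuous data; the `n = 1` rung statement (kept verbatim from the node, v5) -/

/-- A representation from a continuous `ℚ`-semialgebraic integrand on a compact `ℚ`-semialgebraic domain
(integrability = continuity on a compact set). [folklore] -/
def contRep {k : ℕ} (D : Set (Fin k → ℝ)) (hD : IsSemialgebraic ℚ D) (hDc : IsCompact D)
    (f : (Fin k → ℝ) → ℝ) (hf : IsSemialgebraicFunOn ℚ D f) (hfc : ContinuousOn f D) : IntegralRep k :=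
  ⟨D, f, hD, hf, hfc.integrableOn_compact hDc⟩

/-- The literal closed unit cube is compact. [folklore] -/
theorem isCompact_cubeLit (m : ℕ) : IsCompact (Set.pi Set.univ fun _ : Fin m => Set.Icc (0:ℝ) 1) :=
  isCompact_univ_pi fun _ => isCompact_Icc

/-- The literal closed unit cube is `ℚ`-semialgebraic. [folklore] -/
theorem isSemialgebraic_cubeLit (m : ℕ) :
    IsSemialgebraic ℚ (Set.pi Set.univ fun _ : Fin m => Set.Icc (0:ℝ) 1) := by
  rw [cubeLit_eq_cube]; exact KZ.isSemialgebraic_cube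

/-- The unit interval in the shape of `Theorems/SoloInformedPiDisc` is the literal cube of dimension one. -/
theorem unitI_eq_cubeLit :
    {x : Fin 1 → ℝ | 0 ≤ x 0 ∧ x 0 ≤ 1} = Set.pi Set.univ (fun _ : Fin 1 => Set.Icc (0:ℝ) 1) := by
  ext x
  simp only [Set.mem_setOf_eq, Set.mem_pi, Set.mem_univ, forall_const, Set.mem_Icc, Fin.forall_fin_one]

/-- rung (`n = 1`) · PROVED (gen 4; below as the case `n = 1` of `PiRationalisationSqrt`,
`piRationalisationSqrtOne_holds`) · a literal special case of the rank-2 crux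
`PiRationalisation` (item 24903; `piRationalisationSqrtOne_of_piRationalisation`): **π-rationalisation on the
hyperelliptic line.** For a one-dimensional cube–Nash representation whose integrand is
`a₁/a₂ + (b₁/b₂)·√p` on `[0,1]` (`a₂, b₂ ≠ 0`, `p > 0` on `[0,1]`, all in `ℚ[x]`) — the simplest class of
ALGEBRAIC, non-rational integrands — every `[π]^K·[s]`, `K ≥ 1`, lies in `relations ⊔ ⟨rational closed-cube
sector⟩`. Outside S's decided regime (no kernel statement for algebraic one-dimensional integrands or for
two-dimensional rational ones is a theorem), and it exercises exactly the route's lever: the algebraic number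
`√p(x)` is absorbed INSIDE the four moves at the price of one `[π]`, by `[π]·[s_B] ≡ 2·[[0,1]², b₁p/(b₂(p(1−σ)²+σ²))]`
(`π·√p = 2∫₀¹ p dσ/(p(1−σ)²+σ²)` fibrewise: doubling substitution + fibred Möbius substitution + Fubini). -/
def PiRationalisationSqrtOne : Prop :=
  ∀ (s : IntegralRep 1) (a₁ a₂ b₁ b₂ p : MvPolynomial (Fin 1) ℚ),
    (∀ z ∈ Set.pi Set.univ (fun _ : Fin 1 => Set.Icc (0:ℝ) 1), aeval z a₂ ≠ 0) →
    (∀ z ∈ Set.pi Set.univ (fun _ : Fin 1 => Set.Icc (0:ℝ) 1), aeval z b₂ ≠ 0) →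
    (∀ z ∈ Set.pi Set.univ (fun _ : Fin 1 => Set.Icc (0:ℝ) 1), 0 < aeval z p) →
    s.domain = Set.pi Set.univ (fun _ : Fin 1 => Set.Icc (0:ℝ) 1) →
    (∀ z ∈ Set.pi Set.univ (fun _ : Fin 1 => Set.Icc (0:ℝ) 1),
      s.integrand z = aeval z a₁ / aeval z a₂ + aeval z b₁ / aeval z b₂ * √(aeval z p)) →
    ∃ K₀ : ℕ, ∀ K : ℕ, K₀ ≤ K →
      (fun x : FormalRep => of piRep * x)^[K] (of s) ∈
        relations ⊔ AddSubgroup.closure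
          {x : FormalRep | ∃ (m : ℕ) (q : IntegralRep m) (P Q : MvPolynomial (Fin m) ℚ),
            q.domain = Set.pi Set.univ (fun _ : Fin m => Set.Icc (0:ℝ) 1) ∧
            (∀ z ∈ Set.pi Set.univ (fun _ : Fin m => Set.Icc (0:ℝ) 1), aeval z Q ≠ 0) ∧
            (∀ z ∈ Set.pi Set.univ (fun _ : Fin m => Set.Icc (0:ℝ) 1), q.integrand z = aeval z P / aeval z Q) ∧
            x = of q}

/-! ### The fibred Möbius substitution over the base cube `[0,1]^m` and the rung for EVERY `n`
(the degree-2 layer of `PiRationalisation` in all dimensions) -/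

/-- The FIBRED MÖBIUS substitution over the base cube `[0,1]^m`: with `c = √p(x)` (`p > 0` on `[0,1]^m`),
`σ = σ'/(c + (1−c)σ')` maps `[0,1]` onto itself fibrewise with `dσ = c dσ'/(c + (1−c)σ')²`, and
`c · dσ/((1−σ)²+σ²) = c² dσ'/(c²(1−σ')²+σ'²)` is RATIONAL in `(x, σ')` because `c² = p(x)`:
`[[0,1]^{m+1}, b₁p/(b₂(p(1−σ')²+σ'²))] ≡ [[0,1]^m, (b₁/b₂)√p] × [[0,1], dσ/((1−σ)²+σ²)]`. [this node] -/
theorem of_sub_of_mem_relations_sqrtMoebiusN {m : ℕ} (S : IntegralRep m) (C1 : IntegralRep 1)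
    (R : IntegralRep (m + 1)) (b₁ b₂ p : MvPolynomial (Fin m) ℚ)
    (hSd : S.domain = Set.pi Set.univ (fun _ : Fin m => Icc (0:ℝ) 1))
    (hSi : S.integrand = fun y => aeval y b₁ / aeval y b₂ * √(aeval y p))
    (hb₂ : ∀ y ∈ Set.pi Set.univ (fun _ : Fin m => Icc (0:ℝ) 1), aeval y b₂ ≠ 0)
    (hp : ∀ y ∈ Set.pi Set.univ (fun _ : Fin m => Icc (0:ℝ) 1), 0 < aeval y p)
    (hCd : C1.domain = {x | 0 ≤ x 0 ∧ x 0 ≤ 1})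
    (hCi : C1.integrand = fun x => 1 / ((1 - x 0) ^ 2 + x 0 ^ 2))
    (hRd : R.domain = Set.pi Set.univ (fun _ : Fin (m + 1) => Icc (0:ℝ) 1))
    (hRi : R.integrand = fun z =>
      aeval z (rename Fin.castSucc b₁ * rename Fin.castSucc p) /
        aeval z (rename Fin.castSucc b₂ *
          (rename Fin.castSucc p * (1 - X (Fin.last m)) ^ 2 + X (Fin.last m) ^ 2))) :
    of R - of (S.prod C1) ∈ relations := by
  have hcube : ∀ {z : Fin (m + 1) → ℝ}, z ∈ R.domain →
      Fin.init z ∈ Set.pi Set.univ (fun _ : Fin m => Icc (0:ℝ) 1) ∧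
        0 ≤ z (Fin.last m) ∧ z (Fin.last m) ≤ 1 := by
    intro z hz
    rw [hRd, mem_univ_pi] at hz
    exact ⟨mem_univ_pi.mpr fun i => hz (Fin.castSucc i), (hz (Fin.last m)).1, (hz (Fin.last m)).2⟩
  -- the fibrewise constant `c = √p(x)`
  set c : (Fin (m + 1) → ℝ) → ℝ := fun z => √(aeval z (rename Fin.castSucc p)) with hc_def
  have hc : ∀ z, c z = √(aeval (Fin.init z) p) := fun z => by
    simp only [hc_def, aeval_rename_castSucc]
  have hc_snoc : ∀ (y : Fin m → ℝ) (t : ℝ), c (Fin.snoc y t) = √(aeval y p) := fun y t => by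
    rw [hc, Fin.init_snoc]
  have hc_pos : ∀ {z}, z ∈ R.domain → 0 < c z := fun hz => by
    rw [hc]; exact Real.sqrt_pos.2 (hp _ (hcube hz).1)
  have hc_sq : ∀ {z}, z ∈ R.domain → c z ^ 2 = aeval (Fin.init z) p := fun hz => by
    rw [hc]; exact Real.sq_sqrt (hp _ (hcube hz).1).le
  have hden : ∀ {z}, z ∈ R.domain → 0 < c z + (1 - c z) * z (Fin.last m) := fun hz =>
    moebius_den_pos (hc_pos hz) (hcube hz).2.1 (hcube hz).2.2
  refine of_sub_of_mem_relations_of_fibreMap (m := m) (G := Set.pi Set.univ (fun _ : Fin m => Icc (0:ℝ) 1))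
    (a := fun _ => 0) (b := fun _ => 1) (a' := fun _ => 0) (b' := fun _ => 1)
    (fun z => z (Fin.last m) / (c z + (1 - c z) * z (Fin.last m)))
    (fun z => c z / (c z + (1 - c z) * z (Fin.last m)) ^ 2)
    R (S.prod C1) ?_ ?_ (fun _ _ => zero_le_one) ?_ ?_ ?_ ?_ ?_ ?_ ?_
  · -- hr
    rw [hRd]; ext z
    simp only [mem_univ_pi, mem_Icc, KZlog.mem_band, Fin.forall_fin_succ', Fin.init]
  · -- hr'
    rw [IntegralRep.prod_domain]; ext z
    simp only [IntegralRep.mem_prodDomain, hSd, hCd, mem_univ_pi, mem_Icc, mem_setOf_eq, KZlog.mem_band,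
      show (Fin.natAdd m (0 : Fin 1) : Fin (m + 1)) = Fin.last m from Fin.ext (by simp), Fin.init, Fin.castSucc]
  · -- semialgebraic
    have hsa := R.isSemialgebraic_domain
    have hl : IsSemialgebraicFunOn ℚ R.domain (fun z => z (Fin.last m)) := isSemialgebraicFunOn_apply hsa _
    have hcs : IsSemialgebraicFunOn ℚ R.domain c :=
      IsSemialgebraicFunOn.sqrt_holds (isSemialgebraicFunOn_aeval hsa (rename Fin.castSucc p))
    have hD : IsSemialgebraicFunOn ℚ R.domain (fun z => c z + (1 - c z) * z (Fin.last m)) :=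
      (IsSemialgebraicFunOn.add_holds hcs (IsSemialgebraicFunOn.mul_holds
        (IsSemialgebraicFunOn.sub_holds (isSemialgebraicFunOn_ratCast hsa 1) hcs) hl)).congr
        fun z _ => by simp
    exact IsSemialgebraicFunOn.div hl hD fun z hz => (hden hz).ne'
  · -- differentiable
    intro z hz
    have hP : DifferentiableAt ℝ (fun w : Fin (m + 1) → ℝ => aeval w (rename Fin.castSucc p)) z :=
      (Literature.ModelTheory.ExponentialFields.analyticOnNhd_aeval (k := ℚ) (rename Fin.castSucc p) z
        (mem_univ _)).differentiableAt
    have hc' : DifferentiableAt ℝ c z := by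
      rw [hc_def]
      refine hP.sqrt ?_
      rw [aeval_rename_castSucc]; exact (hp _ (hcube hz).1).ne'
    have hl : DifferentiableAt ℝ (fun w : Fin (m + 1) → ℝ => w (Fin.last m)) z := by fun_prop
    have hD : DifferentiableAt ℝ (fun w : Fin (m + 1) → ℝ => c w + (1 - c w) * w (Fin.last m)) z := by
      fun_prop
    simp only [div_eq_mul_inv]
    exact hl.fun_mul (hD.fun_inv (hden hz).ne')
  · -- fibre derivative
    intro z hz
    have hd := hden hz
    have hcz := hc_pos hz
    simp only [Fin.snoc_last, hc_snoc, ← hc z]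
    set σ₀ : ℝ := z (Fin.last m) with hσ₀
    set k : ℝ := c z with hk
    have h1 := ((hasDerivAt_id' σ₀).const_mul (1 - k)).const_add k
    have h2 := (hasDerivAt_id' σ₀).fun_div h1 hd.ne'
    refine h2.congr_deriv ?_
    have hD0 : k + (1 - k) * σ₀ ≠ 0 := hd.ne'
    rw [div_eq_div_iff (pow_ne_zero 2 hD0) (pow_ne_zero 2 hD0)]
    ring
  · -- positivity
    intro z hz
    exact div_pos (hc_pos hz) (pow_pos (hden hz) 2)
  · intro y _; simp only [Fin.snoc_last, zero_div]
  · intro y hy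
    simp only [Fin.snoc_last]
    have : c (Fin.snoc y 1) + (1 - c (Fin.snoc y 1)) * 1 = 1 := by ring
    rw [this, div_one]
  · -- integrand identity
    intro z hz
    have hd := hden hz
    have hcz := hc_pos hz
    have hin := (hcube hz).1
    have hb := hb₂ _ hin
    have hsq := hc_sq hz
    rw [hRi, IntegralRep.prod_integrand_eq]
    simp only [IntegralRep.prodFun, hSi, hCi]
    -- coordinates of the substituted point
    have e1 : (fun i : Fin m => (Fin.snoc (Fin.init z) (z (Fin.last m) / (c z + (1 - c z) * z (Fin.last m))) :
        Fin (m + 1) → ℝ) (Fin.castAdd 1 i)) = Fin.init z := by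
      funext i
      exact Fin.snoc_castSucc (α := fun _ => ℝ) _ _ i
    have e2 : (Fin.snoc (Fin.init z) (z (Fin.last m) / (c z + (1 - c z) * z (Fin.last m))) :
        Fin (m + 1) → ℝ) (Fin.natAdd m 0) = z (Fin.last m) / (c z + (1 - c z) * z (Fin.last m)) := by
      rw [show (Fin.natAdd m (0 : Fin 1) : Fin (m + 1)) = Fin.last m from Fin.ext (by simp)]
      exact Fin.snoc_last (α := fun _ => ℝ) (x := _) (p := Fin.init z)
    rw [e1, e2]
    simp only [map_mul, map_add, map_pow, map_sub, map_one, MvPolynomial.aeval_X, aeval_rename_castSucc]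
    rw [← hc z, ← hsq]
    set σ : ℝ := z (Fin.last m) with hσ
    set k : ℝ := c z with hk
    set B₁ : ℝ := aeval (Fin.init z) b₁
    set B₂ : ℝ := aeval (Fin.init z) b₂
    have hD0 : k + (1 - k) * σ ≠ 0 := hd.ne'
    have hk0 : k ≠ 0 := hcz.ne'
    have hQ0 : k ^ 2 * (1 - σ) ^ 2 + σ ^ 2 ≠ 0 := (sq_den_pos hcz (hcube hz).2.1).ne'
    set D : ℝ := k + (1 - k) * σ with hDdef
    set Q : ℝ := k ^ 2 * (1 - σ) ^ 2 + σ ^ 2 with hQdef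
    have hE : (1 - σ / D) ^ 2 + (σ / D) ^ 2 = Q / D ^ 2 := by
      have e : 1 - σ / D = k * (1 - σ) / D := by
        rw [eq_div_iff hD0, sub_mul, div_mul_cancel₀ _ hD0, hDdef]
        ring
      rw [e, div_pow, div_pow, ← add_div, hQdef]
      ring
    rw [hE]
    field_simp

/-- rung (all dimensions) · PROVED (gen 4, `piRationalisationSqrt_of_arctanRep`, `piRationalisationSqrt_holds`) · a literal special case of the
rank-2 crux `PiRationalisation` (item 24903; `piRationalisationSqrt_of_piRationalisation`): **π-rationalisation of
quadratic irrationalities in every dimension.** For a cube–Nash representation in dimension `n` whose integrand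
is `a₁/a₂ + (b₁/b₂)·√p` on `[0,1]ⁿ` (`a₂, b₂` zero-free and `p > 0` on `[0,1]ⁿ`, all in `ℚ[x₁,…,xₙ]`) — this is the
generic DEGREE-2 layer of `PiRationalisation` (Nash integrands quadratic over `ℚ(x)` with leading coefficient and
discriminant zero-free on the cube) — every `[π]^K·[s]`, `K ≥ 1`, lies in `relations ⊔ ⟨rational closed-cube
sector⟩`, by `[π]·[s_B] ≡ 2·[[0,1]ⁿ⁺¹, b₁p/(b₂(p(1−σ)²+σ²))]` (doubling substitution + commutator/Fubini + the
fibred Möbius substitution over the base `[0,1]ⁿ`, `of_sub_of_mem_relations_sqrtMoebiusN`). -/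
def PiRationalisationSqrt : Prop :=
  ∀ (n : ℕ) (s : IntegralRep n) (a₁ a₂ b₁ b₂ p : MvPolynomial (Fin n) ℚ),
    (∀ z ∈ Set.pi Set.univ (fun _ : Fin n => Set.Icc (0:ℝ) 1), aeval z a₂ ≠ 0) →
    (∀ z ∈ Set.pi Set.univ (fun _ : Fin n => Set.Icc (0:ℝ) 1), aeval z b₂ ≠ 0) →
    (∀ z ∈ Set.pi Set.univ (fun _ : Fin n => Set.Icc (0:ℝ) 1), 0 < aeval z p) →
    s.domain = Set.pi Set.univ (fun _ : Fin n => Set.Icc (0:ℝ) 1) →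
    (∀ z ∈ Set.pi Set.univ (fun _ : Fin n => Set.Icc (0:ℝ) 1),
      s.integrand z = aeval z a₁ / aeval z a₂ + aeval z b₁ / aeval z b₂ * √(aeval z p)) →
    ∃ K₀ : ℕ, ∀ K : ℕ, K₀ ≤ K →
      (fun x : FormalRep => of piRep * x)^[K] (of s) ∈
        relations ⊔ AddSubgroup.closure
          {x : FormalRep | ∃ (m : ℕ) (q : IntegralRep m) (P Q : MvPolynomial (Fin m) ℚ),
            q.domain = Set.pi Set.univ (fun _ : Fin m => Set.Icc (0:ℝ) 1) ∧
            (∀ z ∈ Set.pi Set.univ (fun _ : Fin m => Set.Icc (0:ℝ) 1), aeval z Q ≠ 0) ∧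
            (∀ z ∈ Set.pi Set.univ (fun _ : Fin m => Set.Icc (0:ℝ) 1), q.integrand z = aeval z P / aeval z Q) ∧
            x = of q}

end Summit.KontsevichZagierPeriods.RootDecompRationalCubeDichotomy.Rung24903
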